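import Summits.Ventures.DiscreteObjects.PP12.ElationQuotientSTD
import Summits.Ventures.DiscreteObjects.PP12.LiveCells

/-!
# PP(12) with an involution = a liftable STD₂[12;6]: the GF(2) lift system, and the live cell reduced to a finite statement (kernel)
Framing: lottery ticket; floor = certified bounds/negative ranges.

Cell pub-namedobj (venture DiscreteObjects), target (M), designs gen 9.  Family F-INV2 of the census reduces 'a projective plane of
order 12 with an involution' to 'an STD₂[12;6] whose GF(2) LIFT SYSTEM is consistent' (FAMILY-INV2.md; decided cell by cell by two
engines).  `ElationQuotientSTD` gave the STD₂[12;6] (`exists_quotientSTD2_of_involution`).  This file formalises the lift system and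
proves the reduction in the kernel:

* `STD.LiftableZ2 π φ` — for an incidence array `π : IncArray k u` and a GF(2)-voltage `φ i a j` on its flags (the flag of the point
  `(i,a)` in block class `j`), the LINEAR system over `ZMod 2`: for two points of different classes and their common blocks in classes
  `j₁ ≠ j₂` the four voltages sum to `1`, and dually for two blocks of different classes and their common points in classes `i₁ ≠ i₂`;
* **`exists_liftableZ2_of_involution`** — a finite projective plane of order `n` with a non-trivial involutory elation `σ` (axis `l`,
  centre `c ∈ l`) yields an `IsSTD 2` array `π : IncArray n (n/2)` AND a voltage `φ` with `LiftableZ2 π φ`: choosing a point `x_X`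
  in every `σ`-orbit `X` off `l` and a line `m_B` in every `σ`-orbit `B` avoiding `c`, put `φ(X,B) = 0` if `x_X ∈ m_B` and `1` if
  `x_X ∈ σ m_B`; then `σˢ x_X ∈ σᵗ m_B ↔ (X on B) ∧ φ(X,B) = s + t` (`lift_mem_iff`), and 'two points lie on ONE line' / 'two lines
  meet in ONE point' in the plane are exactly the two halves of the system;
* **`noInvolutionOrder12_of_no_liftableZ2`** — hence the census statement `NoInvolutionOrder12` (`LiveCells`, p-typed: no projective
  plane of order 12 admits an involution) FOLLOWS from the finite statement 'no `π : IncArray 12 6` with `IsSTD 2 π` admits a voltage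
  `φ : Fin 12 → Fin 6 → Fin 12 → ZMod 2` solving the lift system' — the live cell `|G| = 2` of PP(12) is reduced, in the kernel, to a
  property of 12 × 12 arrays of permutations of `Fin 6` (not decided here: STD₂[12;6] are not classified; the census decides it per
  STD found, by Gaussian elimination ×2 engines).
Classical covering-design material (Suetake 2002; Gibbons–Mathon-style lifting); formalisation ours; no `sorry`.
-/

namespace Summit.Ventures.DiscreteObjects.STD

/-- **The GF(2) lift system of an incidence array.**  A voltage `φ i a j : ZMod 2` is attached to the flag formed by the point
`(i, a)` and the unique block of class `j` through it.  The system asks: (points) for `i ≠ i'`, labels `a, a'` and two block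
classes `j₁ ≠ j₂` in which the two points share their block, `φ i a j₁ + φ i' a' j₁ + φ i a j₂ + φ i' a' j₂ = 1`; (blocks) for
`j ≠ j'`, labels `b, b'` and two point classes `i₁ ≠ i₂` in which the two blocks share their point, the four voltages of those
flags sum to `1`.  (For an `IsSTD 2` array each pair has exactly two such classes; the system says the double cover defined by
`φ` joins two points by exactly one line and dually.) -/
def LiftableZ2 {k u : ℕ} (π : IncArray k u) (φ : Fin k → Fin u → Fin k → ZMod 2) : Prop :=
  (∀ i i' : Fin k, i ≠ i' → ∀ (a a' : Fin u) (j₁ j₂ : Fin k), j₁ ≠ j₂ →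
      π i j₁ a = π i' j₁ a' → π i j₂ a = π i' j₂ a' → φ i a j₁ + φ i' a' j₁ + φ i a j₂ + φ i' a' j₂ = 1) ∧
  (∀ j j' : Fin k, j ≠ j' → ∀ (b b' : Fin u) (i₁ i₂ : Fin k), i₁ ≠ i₂ →
      (π i₁ j).symm b = (π i₁ j').symm b' → (π i₂ j).symm b = (π i₂ j').symm b' →
      φ i₁ ((π i₁ j).symm b) j + φ i₁ ((π i₁ j).symm b) j' + φ i₂ ((π i₂ j).symm b) j + φ i₂ ((π i₂ j).symm b) j' = 1)

end Summit.Ventures.DiscreteObjects.STD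

namespace Summit.Ventures.DiscreteObjects.PP12

open Configuration Finset Summit.Ventures.DiscreteObjects.STD
open scoped Classical

namespace Collineation

variable {P L : Type*} [Membership P L] [ProjectivePlane P L] [Fintype P] [Fintype L] (σ : Collineation P L)

/-- `∃ t < 2, Q t` means `Q 0 ∨ Q 1`. -/
theorem exists_lt_two_iff (Q : ℕ → Prop) : (∃ t < 2, Q t) ↔ Q 0 ∨ Q 1 := by
  constructor
  · rintro ⟨t, ht, h⟩
    interval_cases t
    · exact Or.inl h
    · exact Or.inr h
  · rintro (h | h)
    · exact ⟨0, by norm_num, h⟩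
    · exact ⟨1, by norm_num, h⟩

/-- arithmetic in `ZMod 2` used below -/
theorem zmod2_facts : (∀ x y : ZMod 2, x + y + x = y) ∧ (∀ x y : ZMod 2, x + (x + y) = y) ∧
    (∀ x y : ZMod 2, x + y = 0 → x = y) ∧ (∀ x : ZMod 2, x ≠ 1 → x = 0) ∧ ((1 : ZMod 2) + 1 = 0) := by
  refine ⟨by decide, by decide, by decide, by decide, by decide⟩

/-- **A projective plane with an involutory elation is a LIFTABLE double cover of an STD₂[n; n/2].**  See the module
docstring. -/
theorem exists_liftableZ2_of_involution {l : L} {c : P} (hl : σ.IsAxis l) (hc : σ.IsCenter c) (hcl : c ∈ l)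
    (hne : σ.onPoints ≠ 1) (hq : σ.onPoints ^ 2 = 1) {n : ℕ} (hn : ProjectivePlane.order P L = n) :
    ∃ (π : IncArray n (n / 2)) (φ : Fin n → Fin (n / 2) → Fin n → ZMod 2), IsSTD 2 π ∧ LiftableZ2 π φ := by
  obtain ⟨-, π, gP, gL, hSTD, hPs, hLs, hPfib, hLfib, hinc⟩ :=
    σ.exists_quotientSTD_of_elation hl hc hcl hne Nat.prime_two hq hn
  -- involution facts
  have σσ : ∀ x : P, σ.onPoints (σ.onPoints x) = x := σ.apply_apply_of_sq hq
  have hqL : σ.onLines ^ 2 = 1 := σ.onLines_pow_eq_one hq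
  have σσL : ∀ m : L, σ.onLines (σ.onLines m) = m := fun m => by
    have h := congrArg (fun τ : Equiv.Perm L => τ m) hqL
    simpa [pow_two] using h
  have memσ : ∀ (x : P) (m : L), x ∈ σ.onLines m ↔ σ.onPoints x ∈ m := fun x m => by
    have h := σ.mem_iff (σ.onPoints x) m
    rwa [σσ] at h
  have hcσ : ∀ m : L, c ∉ m → c ∉ σ.onLines m := fun m hm h => by
    rw [memσ, σ.center_fixed hl hc] at h; exact hm h
  -- two points of an orbit never lie on a common line avoiding `c`
  have not_both : ∀ (x : P) (m : L), x ∉ l → c ∉ m → x ∈ m → σ.onPoints x ∈ m → False := by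
    intro x m hx hm h1 h2
    have hxc : x ≠ c := fun h => hx (h ▸ hcl)
    have hmov : σ.onPoints x ≠ x := σ.moved_of_not_mem_axis hl hc hcl hne hx
    have h3 : σ.onPoints x ∈ (HasLines.mkLine hxc : L) := σ.image_mem_classLine hc hxc
    have hm' : m = HasLines.mkLine hxc :=
      (Nondegenerate.eq_or_eq h1 h2 (HasLines.mkLine_ax hxc).1 h3).resolve_left hmov.symm
    apply hm; rw [hm']; exact (HasLines.mkLine_ax hxc).2
  -- sections of the orbit maps
  have hsP : ∀ X, gP (Function.surjInv hPs X) = X := Function.surjInv_eq hPs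
  have hsL : ∀ B, gL (Function.surjInv hLs B) = B := Function.surjInv_eq hLs
  set x₀ : Fin n × Fin (n / 2) → P := fun X => (Function.surjInv hPs X).1 with hx₀
  set m₀ : Fin n × Fin (n / 2) → L := fun B => (Function.surjInv hLs B).1 with hm₀
  have hx₀l : ∀ X, x₀ X ∉ l := fun X => (Function.surjInv hPs X).2
  have hm₀c : ∀ B, c ∉ m₀ B := fun B => (Function.surjInv hLs B).2
  have hgP0 : ∀ X, gP ⟨x₀ X, hx₀l X⟩ = X := hsP
  have hgP1 : ∀ X, gP ⟨σ.onPoints (x₀ X), σ.map_not_mem_axis hl (hx₀l X)⟩ = X := fun X => by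
    have h := (hPfib ⟨x₀ X, hx₀l X⟩ ⟨σ.onPoints (x₀ X), σ.map_not_mem_axis hl (hx₀l X)⟩).2
      ⟨1, by norm_num, by simp⟩
    rw [hgP0] at h; exact h.symm
  have hgL0 : ∀ B, gL ⟨m₀ B, hm₀c B⟩ = B := hsL
  have hgL1 : ∀ B, gL ⟨σ.onLines (m₀ B), hcσ _ (hm₀c B)⟩ = B := fun B => by
    have h := (hLfib ⟨m₀ B, hm₀c B⟩ ⟨σ.onLines (m₀ B), hcσ _ (hm₀c B)⟩).2 ⟨1, by norm_num, by simp⟩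
    rw [hgL0] at h; exact h.symm
  -- incidence of the STD in terms of the representatives
  have on_iff : ∀ (i : Fin n) (a : Fin (n / 2)) (j : Fin n) (b : Fin (n / 2)),
      π i j a = b ↔ x₀ (i, a) ∈ m₀ (j, b) ∨ σ.onPoints (x₀ (i, a)) ∈ m₀ (j, b) := by
    intro i a j b
    have h := hinc (Function.surjInv hPs (i, a)) (Function.surjInv hLs (j, b))
    rw [hsP, hsL] at h
    dsimp only at h
    rw [h, exists_lt_two_iff, pow_zero, pow_one, Equiv.Perm.one_apply]
  -- the voltage
  let φ : Fin n → Fin (n / 2) → Fin n → ZMod 2 := fun i a j => if x₀ (i, a) ∈ m₀ (j, π i j a) then 0 else 1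
  -- lifted points and lines
  let pt : Fin n × Fin (n / 2) → ZMod 2 → P := fun X s => if s = 0 then x₀ X else σ.onPoints (x₀ X)
  let ln : Fin n × Fin (n / 2) → ZMod 2 → L := fun B t => if t = 0 then m₀ B else σ.onLines (m₀ B)
  obtain ⟨zA, zB, zC, zD, z11⟩ := zmod2_facts
  -- the basic lift incidence
  have case00 : ∀ i a j b, x₀ (i, a) ∈ m₀ (j, b) ↔ π i j a = b ∧ φ i a j = 0 := by
    intro i a j b
    constructor
    · intro h
      have hon : π i j a = b := (on_iff i a j b).2 (Or.inl h)
      refine ⟨hon, ?_⟩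
      simp only [φ, hon, h, if_true]
    · rintro ⟨hon, hφ⟩
      by_contra h
      rw [← hon] at h
      simp only [φ, h, if_false] at hφ
      exact absurd hφ (by decide)
  have case10 : ∀ i a j b, σ.onPoints (x₀ (i, a)) ∈ m₀ (j, b) ↔ π i j a = b ∧ φ i a j = 1 := by
    intro i a j b
    constructor
    · intro h
      have hon : π i j a = b := (on_iff i a j b).2 (Or.inr h)
      refine ⟨hon, ?_⟩
      have hnot : x₀ (i, a) ∉ m₀ (j, π i j a) := by
        rw [hon]; exact fun h0 => not_both _ _ (hx₀l _) (hm₀c _) h0 h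
      simp only [φ, hnot, if_false]
    · rintro ⟨hon, hφ⟩
      have hnot : x₀ (i, a) ∉ m₀ (j, b) := by
        intro h0; rw [← hon] at h0
        simp only [φ, h0, if_true] at hφ
        exact absurd hφ (by decide)
      exact ((on_iff i a j b).1 hon).resolve_left hnot
  have zE : ∀ x : ZMod 2, x ≠ 0 → x = 1 := by decide
  have lift_mem_iff : ∀ (i : Fin n) (a : Fin (n / 2)) (j : Fin n) (b : Fin (n / 2)) (s t : ZMod 2),
      pt (i, a) s ∈ ln (j, b) t ↔ π i j a = b ∧ φ i a j = s + t := by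
    intro i a j b s t
    by_cases hs : s = 0 <;> by_cases ht : t = 0
    · subst hs; subst ht
      show x₀ (i, a) ∈ m₀ (j, b) ↔ _
      rw [case00, add_zero]
    · subst hs; obtain rfl := zE t ht
      show x₀ (i, a) ∈ σ.onLines (m₀ (j, b)) ↔ _
      rw [memσ, case10, zero_add]
    · obtain rfl := zE s hs; subst ht
      show σ.onPoints (x₀ (i, a)) ∈ m₀ (j, b) ↔ _
      rw [case10, add_zero]
    · obtain rfl := zE s hs; obtain rfl := zE t ht
      show σ.onPoints (x₀ (i, a)) ∈ σ.onLines (m₀ (j, b)) ↔ _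
      rw [memσ, σσ, case00, z11]
  -- classes of lifted points / lines
  have gP_pt : ∀ X s, ∃ h, gP ⟨pt X s, h⟩ = X := fun X s => by
    by_cases hs : s = 0
    · subst hs
      show ∃ h : x₀ X ∉ l, gP ⟨x₀ X, h⟩ = X
      exact ⟨hx₀l X, hgP0 X⟩
    · obtain rfl := zE s hs
      show ∃ h : σ.onPoints (x₀ X) ∉ l, gP ⟨σ.onPoints (x₀ X), h⟩ = X
      exact ⟨_, hgP1 X⟩
  have gL_ln : ∀ B t, ∃ h, gL ⟨ln B t, h⟩ = B := fun B t => by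
    by_cases ht : t = 0
    · subst ht
      show ∃ h : c ∉ m₀ B, gL ⟨m₀ B, h⟩ = B
      exact ⟨hm₀c B, hgL0 B⟩
    · obtain rfl := zE t ht
      show ∃ h : c ∉ σ.onLines (m₀ B), gL ⟨σ.onLines (m₀ B), h⟩ = B
      exact ⟨_, hgL1 B⟩
  have pt_ne : ∀ X Y s r, X.1 ≠ Y.1 → pt X s ≠ pt Y r := by
    intro X Y s r hXY h
    obtain ⟨h1, e1⟩ := gP_pt X s
    obtain ⟨h2, e2⟩ := gP_pt Y r
    have : (⟨pt X s, h1⟩ : {x : P // x ∉ l}) = ⟨pt Y r, h2⟩ := Subtype.ext h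
    rw [this, e2] at e1
    exact hXY (congrArg Prod.fst e1.symm)
  have ln_ne : ∀ B B' t t', B.1 ≠ B'.1 → ln B t ≠ ln B' t' := by
    intro B B' t t' hBB h
    obtain ⟨h1, e1⟩ := gL_ln B t
    obtain ⟨h2, e2⟩ := gL_ln B' t'
    have : (⟨ln B t, h1⟩ : {m : L // c ∉ m}) = ⟨ln B' t', h2⟩ := Subtype.ext h
    rw [this, e2] at e1
    exact hBB (congrArg Prod.fst e1.symm)
  refine ⟨π, φ, hSTD, ?_, ?_⟩
  · -- the point half of the lift system: two points lie on only one line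
    intro i i' hii' a a' j₁ j₂ hj h1 h2
    by_contra hsum
    have hsum0 := zD _ hsum
    -- v := φ(X,B₁) + φ(Y,B₁) = φ(X,B₂) + φ(Y,B₂)
    set v := φ i a j₁ + φ i' a' j₁ with hv
    have hv2 : v = φ i a j₂ + φ i' a' j₂ := zC _ _ (by rw [← add_assoc]; exact hsum0)
    have hP1 : pt (i, a) 0 ∈ ln (j₁, π i j₁ a) (φ i a j₁) := (lift_mem_iff _ _ _ _ _ _).2 ⟨rfl, by rw [zero_add]⟩
    have hQ1 : pt (i', a') v ∈ ln (j₁, π i j₁ a) (φ i a j₁) :=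
      (lift_mem_iff _ _ _ _ _ _).2 ⟨h1.symm, by rw [hv, zA]⟩
    have hP2 : pt (i, a) 0 ∈ ln (j₂, π i j₂ a) (φ i a j₂) := (lift_mem_iff _ _ _ _ _ _).2 ⟨rfl, by rw [zero_add]⟩
    have hQ2 : pt (i', a') v ∈ ln (j₂, π i j₂ a) (φ i a j₂) :=
      (lift_mem_iff _ _ _ _ _ _).2 ⟨h2.symm, by rw [hv2, zA]⟩
    rcases Nondegenerate.eq_or_eq hP1 hQ1 hP2 hQ2 with h | h
    · exact pt_ne (i, a) (i', a') 0 v hii' h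
    · exact ln_ne (j₁, π i j₁ a) (j₂, π i j₂ a) _ _ hj h
  · -- the block half: two lines meet in only one point
    intro j j' hjj' b b' i₁ i₂ hi h1 h2
    by_contra hsum
    have hsum0 := zD _ hsum
    set a₁ := (π i₁ j).symm b with ha₁
    set a₂ := (π i₂ j).symm b with ha₂
    set v := φ i₁ a₁ j + φ i₁ a₁ j' with hv
    have hv2 : v = φ i₂ a₂ j + φ i₂ a₂ j' := zC _ _ (by rw [← add_assoc]; exact hsum0)
    have on1 : π i₁ j a₁ = b := by rw [ha₁, Equiv.apply_symm_apply]
    have on1' : π i₁ j' a₁ = b' := by rw [h1, Equiv.apply_symm_apply]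
    have on2 : π i₂ j a₂ = b := by rw [ha₂, Equiv.apply_symm_apply]
    have on2' : π i₂ j' a₂ = b' := by rw [h2, Equiv.apply_symm_apply]
    have hP1 : pt (i₁, a₁) (φ i₁ a₁ j) ∈ ln (j, b) 0 := (lift_mem_iff _ _ _ _ _ _).2 ⟨on1, by rw [add_zero]⟩
    have hP1' : pt (i₁, a₁) (φ i₁ a₁ j) ∈ ln (j', b') v := (lift_mem_iff _ _ _ _ _ _).2 ⟨on1', by rw [hv, zB]⟩
    have hP2 : pt (i₂, a₂) (φ i₂ a₂ j) ∈ ln (j, b) 0 := (lift_mem_iff _ _ _ _ _ _).2 ⟨on2, by rw [add_zero]⟩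
    have hP2' : pt (i₂, a₂) (φ i₂ a₂ j) ∈ ln (j', b') v := (lift_mem_iff _ _ _ _ _ _).2 ⟨on2', by rw [hv2, zB]⟩
    rcases Nondegenerate.eq_or_eq hP1 hP2 hP1' hP2' with h | h
    · exact pt_ne (i₁, a₁) (i₂, a₂) _ _ hi h
    · exact ln_ne (j, b) (j', b') 0 v hjj' h

/-- **The live cell `|G| = 2` of PP(12), reduced to a finite statement (kernel).**  If no STD₂[12;6] incidence array admits a
GF(2) voltage solving the lift system, then no projective plane of order 12 admits an involution
(`LiveCells.NoInvolutionOrder12`). -/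
theorem noInvolutionOrder12_of_no_liftableZ2
    (h : ∀ π : IncArray 12 6, IsSTD 2 π → ∀ φ : Fin 12 → Fin 6 → Fin 12 → ZMod 2, ¬ LiftableZ2 π φ) :
    NoInvolutionOrder12 := by
  intro P L _ _ _ _ h12 σ hq
  by_contra hne
  obtain ⟨l, c, hl, hc, hcl⟩ := σ.elation_of_sq h12 hne hq
  obtain ⟨π, φ, hπ, hφ⟩ := σ.exists_liftableZ2_of_involution hl hc hcl hne hq h12
  exact h π hπ φ hφ

end Collineation

end Summit.Ventures.DiscreteObjects.PP12
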